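import Summits.BirchSwinnertonDyer.BirchSwinnertonDyer.Theorems.Rank1ResidualJetThm63LocalFactsPrime
import Summits.BirchSwinnertonDyer.BirchSwinnertonDyer.Theorems.KatoDescentTamePotSupersingularJetchevIrreducibleReadingThm52KernelInputsCebotarev
import HarnessLib

/-!
# Crux `JetchevIrreducibleReadingByName` (item 20165, shared K8-t′ / K9) and crux `WildJetchevBoundAtP` (item 19941, K9):
# bsd-jet's road-K END-FORM LINE `JET.tamagawaExponent_le_mInfty_of_localFacts'` (p-JET, tower case) RE-RUN ON THE
# IRREDUCIBLE, ČEBOTAREV-FREE BASE of k8t-c4 g9 (`…Thm52KernelInputsCebotarev`, p519470) — so the registered gaps stubs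
# `stub_thm52KernelGapsAddv` (20165 v4) / `stub_thm52KernelGapsAtP` (19941 candidate v2.1) REDUCE to bsd-jet's closed-input
# list (seat `bsd-potss-k9-c4` g8; route-free; `--supports 20165`, helper; nothing booked, no item closed, BSD is not proved)

WHAT IS PROVED. `tamagawaExponent_le_mInfty_of_localFacts_of_irreducible_of_heegner`: [J] Thm. 5.2 (arXiv Thm. 6.3) at a
core vertex for a row with `E[p]` IRREDUCIBLE and `p ∣ N_E`, with EVERY structure-level parameter of the H63 currency SUPPLIED
BY TREE THEOREMS exactly as in bsd-jet pv-1/pv-2's tower-case chain: the `τ`-equivariant Weil datum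
(`exists_weilDatum_liftAut`), the intrinsic transverse family with its reconciliation (`exists_localTransverseFamily`), the
stringent family `stringentFamily` (x11b3's CONNECTED Kummer condition `im E⁰(K_v)` at minimal places) with `𝒮 ≤ 𝓕`
(`stringentFamily_le_kummer`), its `τ`-stability (`conjActPlace_mem_stringentFamily`), the (δ) data AT THE CARRIER `v₀`
— `Kum_{v₀}/𝒮_{v₀}` cyclic (`isAddCyclic_kummer_quotient_stringentFamily`) of order `p^{ord_p c_{v₀}}`
(`relIndex_stringentFamily_eq_pow`: the local length IS `#Φ_{v₀}(k)[p^∞]`, valid at ANY carrier incl. `v₀ ∣ p`) —, the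
Poitou–Tate packages `C′`, `hdual_q`, `hdual_ℓ` (`GlobalDuality.exists_rowDuality_modified` from the named fact `hPT`), the
disjointness of the carrier pair `{v₀, τv₀}` from the primes of `c`, the sign `e′ = ε(−1)^r`, and the CM facts
(`phi_heegnerPointOfConductor_mem_range_map_ringClassField_holds`, `exists_generator_ringClassGalOver_holds`); then the
irreducible Čebotarev-free assembly `JetchevIrreducibleReadingThm52.tamagawaExponent_le_mInfty_of_kernelInputs_of_irreducible_of_heegner`.
The statement is bsd-jet's `…localFacts'` VERBATIM with `h44 ↦ h44I` ([McC] Prop. 4.4 in the irreducible reading = 20165's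
`stub_prop44Irred`) and `htower ↦ hirr + hpN`. CONCLUSION: `ord_p c_{v₀}(E/K) ≤ m_∞`.

WHAT REMAINS (the complete list, identical to bsd-jet's K1/K3/K4 end forms): named print {`h44I`, `h53` Gross 5.3, `hGZ`
[GZ86 III (3.1)] receptacle, `hPT` Poitou–Tate for Selmer structures}; local print-to-type {`hloc` [J] Lemma 5.2 (i)(ii),
`h𝒯sd` Howard 2.1.9 (ii), `h𝒯σ` Gross §3}; row data at the carrier {minimality, `c_{v₀} ≠ 0`, `Φ_{v₀}` cyclic, `v₀` split
over `N_E`}; the three completion-layer KERNEL GAPS {`htr`, `h49tr`, `h49str` = Jetchev Prop. 4.9 proper at the carrier —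
at `v₀ ∣ p` additive this is x11b3's `localKummerMap_mem_connectedKummerCondition_of_cocycle_of_hasAdditiveReduction`
territory}. Carrier-blind: `v₀` may lie over the additive `p` (19941, bsd-jet K4) or over a multiplicative `q ≠ p` (20165,
K1/K3). HONEST FRAMING: conditional on every displayed input; nothing asserted; 20165, 19941, their stubs and BSD stay open.

References: [cite: Jetchev2008, Thm. 5.1, Lemma 5.2, Thm. 5.2 (p. 821) and proof, Def. 4.8, Prop. 4.9, §3.1.2, Rem. 6.2]
[cite: Howard2004HeegnerKolyvagin, Prop. 2.1.7, Prop. 2.1.9, Thm. 2.1.11, Lemma 2.7.3] [cite: McCallumLMS1991, §3 Cor. 3.2, §4 Prop. 4.4]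
[cite: GrossLMS1991, §3, Prop. 5.3, Prop. 6.2 (1)] [cite: GrossZagier1986, III (3.1)] [cite: MilneADT2006, Ch. I, Prop. 3.8, Thm. 4.10(b)].
-/

set_option autoImplicit false
-- the Theorems directory repeats the summit name (sibling precedent `KatoDescentPotSupersingularAssembly.lean`)
set_option linter.dupNamespace false

noncomputable section

open scoped Classical Pointwise

open WeierstrassCurve IsDedekindDomain NumberField Field Literature.NumberTheory.EllipticCurves
  Literature.NumberTheory.EllipticCurves.ModularForms Literature.NumberTheory.EllipticCurves.Jetchev2008
  Literature.NumberTheory.GaloisRepresentations Literature.NumberTheory.GaloisCohomology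
  Literature.NumberTheory.GaloisRepresentations.DiscreteGaloisModule
  Summit.BirchSwinnertonDyer.Rank1Residual.X11b Summit.BirchSwinnertonDyer.Rank1Residual.X11b.Three
  Summit.BirchSwinnertonDyer.Rank1Residual.JET Summit.BirchSwinnertonDyer.Rank1Residual.JET.SelmerVocabulary
  Literature.NumberTheory.Automorphic
  Summit.BirchSwinnertonDyer.BirchSwinnertonDyer.Theorems

namespace Summit.BirchSwinnertonDyer.BirchSwinnertonDyer.Theorems.JetchevIrreducibleLocalFacts

/-- **[J] Thm 5.2 at a core vertex, `E[p]` IRREDUCIBLE, `p ∣ N_E`, every structure-level parameter and the stringent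
family's `τ`-stability supplied by tree theorems** — bsd-jet's `JET.tamagawaExponent_le_mInfty_of_localFacts'` with
`h44 ↦ h44I`, `htower ↦ hirr + hpN`, run on k8t-c4 g9's Čebotarev-free irreducible base. Carrier `v₀` = any split place of
`K` over `N_E` carrying the (δ) data (over the additive `p`: crux 19941; over `q ∥ N`, `q ≠ p`: crux 20165). See the module
docstring for the complete list of what remains. CONCLUSION: `ord_p c_{v₀}(E/K) ≤ m_∞`. CONDITIONAL; nothing asserted.
[cite: Jetchev2008, Thm. 5.2 (p. 821) and proof (pp. 821–823), Rem. 6.2] [cite: Howard2004HeegnerKolyvagin, Prop. 2.1.9, Lemma 2.7.3]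
[cite: McCallumLMS1991, §4 Prop. 4.4] [cite: GrossLMS1991, Prop. 5.3] [cite: GrossZagier1986, III (3.1)] [cite: MilneADT2006, Ch. I, Thm. 4.10(b)] -/
theorem tamagawaExponent_le_mInfty_of_localFacts_of_irreducible_of_heegner
    (h44I : ∀ (W : WeierstrassCurve ℚ) [W.IsElliptic] [W.IsGloballyMinimal] [NeZero (W.conductorNorm ℤ)],
        ¬ W.HasCM →
        ∀ (K : Type) [Field K] [NumberField K], IsImaginaryQuadratic K →
        NumberField.discr K ≠ -3 → NumberField.discr K ≠ -4 →
        SatisfiesHeegnerHypothesis (W.conductorNorm ℤ) K →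
        ∀ (p : ℕ) [Fact p.Prime], p ≠ 2 → W.HasIrreducibleModPGaloisRep p →
        ∀ (Dt : ModularParametrizationData W (W.conductorNorm ℤ)) (β : ℤ) (ι : K →+* ℂ)
          (M : ℕ), 1 ≤ M →
        ∀ (m l : ℕ), Squarefree (m * l) → l.Prime → ¬ l ∣ m →
          (∀ l' ∈ (m * l).primeFactors, Zhang2014.IsKolyvaginPrime (W.conductorNorm ℤ) W K p l' ∧
            M ≤ Zhang2014.kolyvaginIndex W p l') →
        ∀ (d : KolyvaginHeegnerData Dt β ι m) (d' : KolyvaginHeegnerData Dt β ι (m * l)),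
          (∀ l' ∈ m.primeFactors, ∀ (x : ringClassField K ι m) (x' : ringClassField K ι (m * l)),
            (x : ℂ) = x' → ((d'.σ l' x' : ringClassField K ι (m * l)) : ℂ) = (d.σ l' x : ℂ)) →
          (∀ s ∈ d.S, ∃ s' ∈ d'.S, ∀ (x : ringClassField K ι m) (x' : ringClassField K ι (m * l)),
            (x : ℂ) = x' → ((s' x' : ringClassField K ι (m * l)) : ℂ) = (s x : ℂ)) →
          (∀ s' ∈ d'.S, ∃ s ∈ d.S, ∀ (x : ringClassField K ι m) (x' : ringClassField K ι (m * l)),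
            (x : ℂ) = x' → ((s' x' : ringClassField K ι (m * l)) : ℂ) = (s x : ℂ)) →
          (∀ (x : ringClassField K ι m) (x' : ringClassField K ι (m * l)),
            (x : ℂ) = x' → d'.emb x' = d.emb x) →
        ∀ (v : HeightOneSpectrum (𝓞 K)), (l : 𝓞 K) ∈ v.asIdeal →
        ∀ (j : ℕ),
          (((p ^ j : ℕ) : ℤ) • d'.kolyvaginClass (Fact.out : p.Prime) M ∈
              selmerLocalKer (W.baseChange K) (v.adicCompletion K) ((p ^ M : ℕ) : ℤ) ↔
            ((p ^ j : ℕ) : ℤ) • d'.kolyvaginClass (Fact.out : p.Prime) M ∈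
              (W.baseChange K).torsionLocalKer (v.adicCompletion K) ((p ^ M : ℕ) : ℤ)) ∧
          (((p ^ j : ℕ) : ℤ) • d'.kolyvaginClass (Fact.out : p.Prime) M ∈
              (W.baseChange K).torsionLocalKer (v.adicCompletion K) ((p ^ M : ℕ) : ℤ) ↔
            ((p ^ j : ℕ) : ℤ) • d.kolyvaginClass (Fact.out : p.Prime) M ∈
              (W.baseChange K).torsionLocalKer (v.adicCompletion K) ((p ^ M : ℕ) : ℤ)))
    (W : WeierstrassCurve ℚ) [W.IsElliptic] [W.IsGloballyMinimal] [NeZero (W.conductorNorm ℤ)]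
    (hcm : ¬ W.HasCM) (K : Type) [Field K] [NumberField K] (hK : IsImaginaryQuadratic K)
    (hD3 : NumberField.discr K ≠ -3) (hD4 : NumberField.discr K ≠ -4)
    (hH : SatisfiesHeegnerHypothesis (W.conductorNorm ℤ) K)
    (hPT : poitouTate_selmerStructure_duality_conj K)
    (p : ℕ) [Fact p.Prime] (hp2 : p ≠ 2) (hirr : W.HasIrreducibleModPGaloisRep p)
    (hpN : p ∣ W.conductorNorm ℤ)
    (Dt : ModularParametrizationData W (W.conductorNorm ℤ)) (β : ℤ) (ι : K →+* ℂ)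
    [∀ j : ℕ, NumberField (ringClassField K ι j)]
    (τ : K ≃ₐ[ℚ] K) (hτ : τ ≠ 1) (hτ2 : τ * τ = 1)
    (ε : ℤ) (hε : ε = 1 ∨ ε = -1)
    (h53 : ∀ (m : ℕ) (dm : KolyvaginHeegnerData Dt β ι m)
      (τm : ringClassField K ι m ≃ₐ[ℚ] ringClassField K ι m),
      (∀ x : ringClassField K ι m, ((τm x : ringClassField K ι m) : ℂ) = starRingEnd ℂ x) →
      ∃ σ' ∈ ringClassGal ι m, IsOfFinAddOrder
        (pointGalHom W (ringClassField K ι m) τm dm.y -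
          ε • pointGalHom W (ringClassField K ι m) σ' dm.y))
    {n' : ℤ} (hcop' : IsCoprime (p : ℤ) n')
    (hGZ : ∀ (m : ℕ) (dm : KolyvaginHeegnerData Dt β ι m)
      (γ : ringClassField K ι m ≃ₐ[ℚ] ringClassField K ι m), γ ∈ ringClassGal ι m →
      ∀ v : HeightOneSpectrum (𝓞 K), ¬ (W.baseChange K).HasGoodReductionAt v →
        n' • pointsMap (W.baseChange K) (v.adicCompletion K)
            (dm.toGeomPoints (pointGalHom W (ringClassField K ι m) γ dm.y)) ∈
          E0Receptacle (W.baseChange K) v ∧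
        ∀ (ℓ : ℕ), ℓ ∈ m.primeFactors → ∀ (dm' : KolyvaginHeegnerData Dt β ι (m / ℓ))
          (hle : ringClassField K ι (m / ℓ) ≤ ringClassField K ι m),
          n' • pointsMap (W.baseChange K) (v.adicCompletion K)
              (dm.toGeomPoints (pointGalHom W (ringClassField K ι m) γ
                (WeierstrassCurve.Affine.Point.map (W' := W)
                  ((RingClassField.inclusion ι hle).restrictScalars ℚ) dm'.y))) ∈
            E0Receptacle (W.baseChange K) v)
    (mdiv m : {c : ℕ // Squarefree c ∧ ∀ ℓ ∈ c.primeFactors,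
        Zhang2014.IsKolyvaginPrime (W.conductorNorm ℤ) W K p ℓ} → ℕ∞)
    (hmdiv : ∀ c (u : ℕ), (u : ℕ∞) ≤ mdiv c ↔ ∀ d : KolyvaginHeegnerData Dt β ι c.1,
      ∃ Q : (W.baseChange (ringClassField K ι c.1)).toAffine.Point,
        ((p ^ u : ℕ) : ℤ) • Q = d.derivedPoint)
    (hm : ∀ c, m c = if mdiv c < Zhang2014.levelIndex W p c.1 then mdiv c else ⊤)
    (k : ℕ) [NeZero (p ^ k)] [Finite (geomTorsion (W.baseChange K) ((p ^ k : ℕ) : ℤ))]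
    (hn : ((p ^ k : ℕ) : ℤ) ≠ 0)
    (c : {c : ℕ // Squarefree c ∧ ∀ ℓ ∈ c.primeFactors,
        Zhang2014.IsKolyvaginPrime (W.conductorNorm ℤ) W K p ℓ}) (hk : 1 ≤ k)
    (hcore : IsGlobalCoreVertex W K ι τ p k c.1) (mInf : ℕ) (hmc : m c = mInf)
    (hkM : (k : ℕ∞) + mInf ≤ Zhang2014.levelIndex W p c.1) (hik : mInf < k)
    -- ROW DATA at the carrier place `v₀`
    (v₀ : HeightOneSpectrum (𝓞 K)) (hv₀ : τ • v₀ ≠ v₀)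
    (hv₀N : ((W.conductorNorm ℤ : ℕ) : 𝓞 K) ∈ v₀.asIdeal)
    [hmin : ((W.baseChange K).baseChange (v₀.adicCompletion K)).IsMinimal (v₀.adicCompletionIntegers K)]
    (hc0 : ((W.baseChange K).baseChange (v₀.adicCompletion K)).localTamagawaNumber
      (v₀.adicCompletionIntegers K) ≠ 0)
    [hΦ : IsAddCyclic (((W.baseChange K).baseChange (v₀.adicCompletion K)).toAffine.Point ⧸
      ((W.baseChange K).baseChange (v₀.adicCompletion K)).goodReductionSubgroup (v₀.adicCompletionIntegers K))]
    (htk : (((W.baseChange K).baseChange (v₀.adicCompletion K)).localTamagawaNumber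
      (v₀.adicCompletionIntegers K)).factorization p < k)
    -- LOCAL PRINT-TO-TYPE: the intrinsic transverse condition is `τ`-stable (Gross §3 dihedral)
    (h𝒯σ : ∀ (𝒯 : SelmerStructure ((W.baseChange K).torsionGaloisModule ((p ^ k : ℕ) : ℤ))),
      (∀ v : HeightOneSpectrum (𝓞 K), 𝒯 (Sum.inr v) =
        ⨅ ℓ ∈ c.1.primeFactors.filter (fun ℓ : ℕ ↦ ((ℓ : ℕ) : 𝓞 K) ∈ v.asIdeal),
          ⨅ (w' : HeightOneSpectrum (𝓞 (ringClassField K ι ℓ))) (_ : w'.asIdeal.LiesOver v.asIdeal),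
            letI := (adicCompletionOfLiesOver K (ringClassField K ι ℓ) v w').toAlgebra
            transverseSubgroup (GaloisRep.toLocal v ((W.baseChange K).torsionGaloisModule ((p ^ k : ℕ) : ℤ)))
              (w'.adicCompletion (ringClassField K ι ℓ))) →
      ∀ (v w : HeightOneSpectrum (𝓞 K)) (h : τ • v = w), v ∈ placesDividing K c.1 →
      ∀ x : galoisCohomology (((W.baseChange K).torsionGaloisModule ((p ^ k : ℕ) : ℤ)).toLocal
        (Sum.inr v : Place K)) 1,
      x ∈ 𝒯 (Sum.inr v) → conjActPlace W τ ((p ^ k : ℕ) : ℤ) h x ∈ 𝒯 (Sum.inr w))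
    -- LOCAL PRINT-TO-TYPE: the intrinsic transverse condition is Lagrangian (Howard 2.1.9 (ii))
    (h𝒯sd : ∀ (𝒯 : SelmerStructure ((W.baseChange K).torsionGaloisModule ((p ^ k : ℕ) : ℤ))),
      (∀ v : HeightOneSpectrum (𝓞 K), 𝒯 (Sum.inr v) =
        ⨅ ℓ ∈ c.1.primeFactors.filter (fun ℓ : ℕ ↦ ((ℓ : ℕ) : 𝓞 K) ∈ v.asIdeal),
          ⨅ (w' : HeightOneSpectrum (𝓞 (ringClassField K ι ℓ))) (_ : w'.asIdeal.LiesOver v.asIdeal),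
            letI := (adicCompletionOfLiesOver K (ringClassField K ι ℓ) v w').toAlgebra
            transverseSubgroup (GaloisRep.toLocal v ((W.baseChange K).torsionGaloisModule ((p ^ k : ℕ) : ℤ)))
              (w'.adicCompletion (ringClassField K ι ℓ))) →
      ∀ (e : geomTorsion (W.baseChange K) ((p ^ k : ℕ) : ℤ) →
          geomTorsion (W.baseChange K) ((p ^ k : ℕ) : ℤ) → AlgebraicClosure K)
        (hμ : ∀ S T, e S T ^ (p ^ k) = 1)
        (hadd₁ : ∀ S₁ S₂ T, e (S₁ + S₂) T = e S₁ T * e S₂ T)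
        (hadd₂ : ∀ S T₁ T₂, e S (T₁ + T₂) = e S T₁ * e S T₂)
        (hgal : ∀ (g : absoluteGaloisGroup K) (S T : geomTorsion (W.baseChange K) ((p ^ k : ℕ) : ℤ)),
          g • e S T = e (g • S) (g • T)),
      (∀ T, e T T = 1) → (∀ T, (∀ S, e S T = 1) → T = 0) →
      ∀ inv : LocalInvariants K (p ^ k), inv.IsPerfect → ∀ v ∈ placesDividing K c.1,
      inv.dualTransported 𝒯 (weilDualIntertwining (W.baseChange K) (p ^ k) e hμ hadd₁ hadd₂ hgal)
        (Sum.inr v) = 𝒯 (Sum.inr v))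
    -- LOCAL PRINT-TO-TYPE (Lemma 5.2 (i)–(ii)) at the Kolyvagin primes `λ ∤ c`
    (hloc : ∀ ℓ : ℕ, Zhang2014.IsKolyvaginPrime (W.conductorNorm ℤ) W K p ℓ →
      k ≤ Zhang2014.kolyvaginIndex W p ℓ → ℓ ∉ c.1.primeFactors →
      ∀ (v : HeightOneSpectrum (𝓞 K)), (ℓ : 𝓞 K) ∈ v.asIdeal → ∀ (hfix : τ • v = v)
        (s : ℤ), s = 1 ∨ s = -1 →
      ((W.baseChange K).kummerSelmerStructure ((p ^ k : ℕ) : ℤ) (Sum.inr v)).relIndex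
        ((conjActPlace W τ ((p ^ k : ℕ) : ℤ) hfix - s • AddMonoidHom.id _).ker) = p ^ k)
    -- KERNEL GAPS (completion layer)
    (htr : ∀ (d : KolyvaginHeegnerData Dt β ι c.1), ∀ ℓ ∈ c.1.primeFactors,
      (d.kolyvaginClass (Fact.out : p.Prime) k :
        galoisCohomology ((W.baseChange K).torsionGaloisModule ((p ^ k : ℕ) : ℤ)) 1) ∈
        transverseKer W K ι ((p ^ k : ℕ) : ℤ) ℓ)
    (h49str : ∀ (ℓ : ℕ), Zhang2014.IsKolyvaginPrime (W.conductorNorm ℤ) W K p ℓ →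
      k ≤ Zhang2014.kolyvaginIndex W p ℓ → ℓ ∉ c.1.primeFactors →
      ∀ (d' : KolyvaginHeegnerData Dt β ι (c.1 * ℓ)), ∀ q ∈ ({v₀, τ • v₀} : Finset _),
      galoisCohomology.localization ((W.baseChange K).torsionGaloisModule ((p ^ k : ℕ) : ℤ))
          (Sum.inr q) 1 (d'.kolyvaginClass (Fact.out : p.Prime) k) ∈ stringentFamily W K hn (Sum.inr q))
    (h49tr : ∀ (ℓ : ℕ), Zhang2014.IsKolyvaginPrime (W.conductorNorm ℤ) W K p ℓ →
      k ≤ Zhang2014.kolyvaginIndex W p ℓ → ℓ ∉ c.1.primeFactors →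
      ∀ (d' : KolyvaginHeegnerData Dt β ι (c.1 * ℓ)), ∀ w ∈ placesDividing K c.1,
      galoisCohomology.localization ((W.baseChange K).torsionGaloisModule ((p ^ k : ℕ) : ℤ))
          (Sum.inr w) 1 (d'.kolyvaginClass (Fact.out : p.Prime) k) ∈
        ⨅ ℓ' ∈ c.1.primeFactors.filter (fun ℓ' : ℕ ↦ ((ℓ' : ℕ) : 𝓞 K) ∈ w.asIdeal),
          ⨅ (w' : HeightOneSpectrum (𝓞 (ringClassField K ι ℓ'))) (_ : w'.asIdeal.LiesOver w.asIdeal),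
            letI := (adicCompletionOfLiesOver K (ringClassField K ι ℓ') w w').toAlgebra
            transverseSubgroup (GaloisRep.toLocal w ((W.baseChange K).torsionGaloisModule ((p ^ k : ℕ) : ℤ)))
              (w'.adicCompletion (ringClassField K ι ℓ'))) :
    (((W.baseChange K).baseChange (v₀.adicCompletion K)).localTamagawaNumber
      (v₀.adicCompletionIntegers K)).factorization p ≤ mInf := by
  have hp : p.Prime := Fact.out
  have hc0' : c.1 ≠ 0 := c.2.1.ne_zero
  -- the Weil datum (theorem)
  have h2 : 2 ≤ p ^ k := by
    calc 2 ≤ p := hp.two_le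
      _ = p ^ 1 := (pow_one p).symm
      _ ≤ p ^ k := Nat.pow_le_pow_right hp.pos hk
  obtain ⟨e, hμ, hadd₁, hadd₂, hgal, halt, hnondeg, hτe⟩ := exists_weilDatum_liftAut W τ (p ^ k) h2
  -- the intrinsic transverse family with its reconciliation (theorem)
  obtain ⟨𝒯, h𝒯, hT⟩ := exists_localTransverseFamily W ι ((p ^ k : ℕ) : ℤ) hc0'
  -- the sign `e' = ε(−1)^r ∈ {±1}` and `s = −e'`
  set e' : ℤ := ε * (-1) ^ c.1.primeFactors.card with he'
  have hs : -e' = 1 ∨ -e' = -1 := by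
    rcases hε with h | h <;> rcases neg_one_pow_eq_or ℤ c.1.primeFactors.card with h' | h' <;>
      simp [he', h, h']
  -- the carrier pair is disjoint from the places dividing `c` (`c` is prime to the conductor)
  have hcopN : Nat.Coprime c.1 (W.conductorNorm ℤ) := by
    refine Nat.coprime_of_dvd fun q hq hqc hqN ↦ ?_
    exact (c.2.2 q (Nat.mem_primeFactors.mpr ⟨hq, hqc, hc0'⟩)).2.1 hqN
  have hQc : Disjoint ({v₀, τ • v₀} : Finset (HeightOneSpectrum (𝓞 K))) (placesDividing K c.1) := by
    rw [Finset.disjoint_left]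
    intro v hv hvc
    have hcv : (c.1 : 𝓞 K) ∈ v.asIdeal := (mem_placesDividing_iff_natCast_mem hc0' v).mp hvc
    simp only [Finset.mem_insert, Finset.mem_singleton] at hv
    rcases hv with rfl | rfl
    · exact Literature.NumberTheory.NumberFields.Honda1971.natCast_notMem_of_coprime hcopN _ hcv hv₀N
    · refine Literature.NumberTheory.NumberFields.Honda1971.natCast_notMem_of_coprime hcopN _ hcv ?_
      have := (HeightOneSpectrum.smul_mem_smul_asIdeal_iff τ v₀ ((W.conductorNorm ℤ : ℕ) : 𝓞 K)).mpr hv₀N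
      rwa [GlobalDuality.smul_natCast_ringOfIntegers] at this
  -- the two Poitou–Tate packages at the stringent family (pv-1, by name), (δ) from `relIndex_stringentFamily_eq_pow`
  obtain ⟨C', hC, hdual_q, hdual_ℓ⟩ := GlobalDuality.exists_rowDuality_modified W τ p k e hμ hadd₁ hadd₂
    hgal halt hnondeg hτe hPT ι hτ2 hp2 hk 𝒯 (stringentFamily W K hn) hc0' hT (h𝒯σ 𝒯 h𝒯)
    (fun inv hinv v hv ↦ h𝒯sd 𝒯 h𝒯 e hμ hadd₁ hadd₂ hgal halt hnondeg inv hinv v hv)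
    (stringentFamily_le_kummer W K hn) v₀ hv₀ hQc
    (fun v w h _ x hx ↦ conjActPlace_mem_stringentFamily W τ hn h hx)
    (isAddCyclic_kummer_quotient_stringentFamily W K hn v₀)
    (relIndex_stringentFamily_eq_pow W K hp k hn v₀ hc0 htk.le)
    (W.conductorNorm ℤ) hv₀N hs
    (fun ℓ h1 h2 h3 v hv hfix ↦ hloc ℓ h1 h2 h3 v hv hfix (-e') hs)
  -- assemble on the irreducible, Čebotarev-free base (CM facts discharged by their `_holds` theorems)
  exact JetchevIrreducibleReadingThm52.tamagawaExponent_le_mInfty_of_kernelInputs_of_irreducible_of_heegner h44I W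
    hcm K hK hD3 hD4 hH (phi_heegnerPointOfConductor_mem_range_map_ringClassField_holds (W.conductorNorm ℤ) W K)
    exists_generator_ringClassGalOver_holds p hp2 hirr hpN Dt β ι τ hτ ε hε h53 hcop' hGZ mdiv m hmdiv hm k c hk
    hcore mInf hmc hkM _ htk hik 𝒯 (stringentFamily W K hn) hT (stringentFamily_le_kummer W K hn) {v₀, τ • v₀}
    hQc e' he' C' hC htr hdual_q h49str
    (fun ℓ h1 h2 h3 d' w hw ↦ by rw [h𝒯 w]; exact h49tr ℓ h1 h2 h3 d' w hw) hdual_ℓ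

end Summit.BirchSwinnertonDyer.BirchSwinnertonDyer.Theorems.JetchevIrreducibleLocalFacts

end
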